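import Mathlib
import HarnessLib
import Summits.HubbardSuperconductivity.HubbardSuperconductivity.Theorems.KLProgrammePolarRayCoareaJacobian
import Summits.HubbardSuperconductivity.HubbardSuperconductivity.Theorems.KLProgrammeMatsubaraSliceBubbleWindow

/-!
# Route `KLProgramme` — crux K3, ENGINE child (stmt-HubbardSuperconductivity-19855 `KLRegimeEngineV12`): the FORWARD particle–hole slice bubble of the
# frame band `e = ε₀ + δ − μ` ON ONE RAY — the level-set Jacobian weight and the transfer shift meet the hypotheses of the window estimates
# (cell gate-hubbard-kl, seat hubbard-kl-k3c2-p2 «thermal-bar induction n ≤ nScales β + 1»)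

The (T)/zero-sound/transfer estimates of this lane (`klte_*`, `klsp_*`, window form `klsw_*`) are stated in the `(k₀, e)` plane with an abstract
insertion `W(e)` and an abstract energy shift; the coarea on the frame's curve (`klrf_*`) and the Jacobian bounds (`klrj_*`) are stated for the
perturbed band `E = ε₀ + δ`.  This module COMPOSES them on one ray `θ`: for the planar integrand family
`h_i(p) = A(p)·Φ_f(ω_i, e(p))·Φ_{f'}(ω_i + q₀, e'(p))` (`Φ_f(k₀,e) = (f(s)/s)(ik₀+e)`, `s = k₀² + e²`, `klfb_prop`; `e = klfb_band δ μ`; `e'` any continuous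
«shifted band» with `|e' − e| ≤ δ_max` on the open square; `A` a continuous planar weight supported in the open square, `‖A‖ ≤ A₀`, radially
`A₁`-Lipschitz) the radial integral `∫_{t>0} t•h_i(t cos θ, t sin θ) dt` equals `∫ W_θ(e)·Φ_f(ω_i,e)·Φ_{f'}(ω_i+q₀, e + σ_θ(e)) de` with the insertion
`W_θ(e) = 𝒥_E(θ,e)·A(ray point)` and the shift `σ_θ(e) = e'(ray point) − e` (`klfb_ray_integral_eq`, `klfb_ray_bubble_integral_eq`), and `W_θ`, `σ_θ`
satisfy the window hypotheses with `B_W = A₀·π√2/d`, `L_W = (π√2/d)·A₁/d + A₀·(1/d² + π√2(2+κ₂)/d³)`, `d = Dt_min − κ₁` (`klfb_weight_*`, `klfb_shift_*`).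
THIS module: the objects (§1), the band along the ray (§2), the one-ray coarea identity for a general planar integrand (§3,
`klfb_ray_integral_eq` = `klry_ray_substitution` with the `klrf_*` level calculus), and the window hypotheses of `W_θ`, `σ_θ` (§4).  The bubble
integrand family, the PER-RAY bound (`klsw_slice_bubble_transfer_norm_le` with these `B_W`, `L_W`) and the PLANAR bound (angle integration,
`klry_norm_smul_sum_integral_le_of_ray_bound`) are the companion module `…ForwardBubblePlanar`.
Pure analysis on the tree's objects; nothing about the model is asserted.
References: BGM 2006 §2.5 (2.56b)–(2.56e); HOME/p1/E2-NOTE.md §3; HOME/hubbard-kl-k3c2-p2/ZS-RECIPE.md §2–§4 (v4), ZS-RECIPE-v5.md; p1 g8 E2-STRUCTURE-NOTE §4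
(Wick rung `g⊗g + g⊗D + D⊗g`: both weight pairs are instances of `(f, f')` here).
-/

noncomputable section

namespace Summit.HubbardSuperconductivity.HubbardSuperconductivity.Theorems.KLRegimeSplit

set_option linter.dupNamespace false -- summit = problem name (single-conjunct summit), D-0017

open Real Set Filter MeasureTheory intervalIntegral Complex Literature.MathematicalPhysics.QuantumLattice
open Literature.MathematicalPhysics.QuantumLattice.BandSectorCounting Literature.Probability.LatticeModels
open Summit.HubbardSuperconductivity.HubbardSuperconductivity.Theorems.PerturbedFermiCurve
open Summit.HubbardSuperconductivity.HubbardSuperconductivity.Theorems.KLProgrammeLegKernels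

/-! ## §1 Objects: the planar frame band, the slice propagator, the ray point and the Jacobian -/

/-- **The frame band on the plane**: `e(p) = ε₀(p) + δ(p) − μ` (`ε₀ = sqDispersion`; `δ = −K` for the counterterm frame `K`). -/
def klfb_band (δ : (Fin 2 → ℝ) → ℝ) (μ : ℝ) (p : ℝ × ℝ) : ℝ := sqDispersion ![p.1, p.2] + δ ![p.1, p.2] - μ

/-- **The propagator of a shell weight `f`** in the singularity-free form `Φ_f(k₀,e) = (f(s)/s)·(ik₀ + e)` (`= f(s)·(−ik₀+e)⁻¹`,
`klsp_div_propagator_eq`), `s = k₀² + e²`. -/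
def klfb_prop (f : ℝ → ℂ) (k₀ e : ℝ) : ℂ := f (k₀ ^ 2 + e ^ 2) / (((k₀ ^ 2 + e ^ 2 : ℝ)) : ℂ) * (I * k₀ + e)

/-- **The ray point at perturbed level `μ + e`**: `u_E(μ+e, θ)·(cos θ, sin θ)`. -/
def klfb_rayPt (δ : (Fin 2 → ℝ) → ℝ) (μ θ e : ℝ) : ℝ × ℝ :=
  (perturbedFermiRadius δ (μ + e) θ * Real.cos θ, perturbedFermiRadius δ (μ + e) θ * Real.sin θ)

/-- **The level-set Jacobian** `𝒥_E(θ, μ+e) = u_E(μ+e,θ)·(∂_tε₀(θ,u_E) + Dδ(u_E·dir θ)[dir θ])⁻¹` (BGM 2006 (2.56b)–(2.56e)). -/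
def klfb_jac (δ : (Fin 2 → ℝ) → ℝ) (μ θ e : ℝ) : ℝ :=
  perturbedFermiRadius δ (μ + e) θ *
    (rayDispersionDt θ (perturbedFermiRadius δ (μ + e) θ) + fderiv ℝ δ (perturbedFermiRadius δ (μ + e) θ • dir θ) (dir θ))⁻¹

/-- Unfolding `klfb_prop`. -/
theorem klfb_prop_apply (f : ℝ → ℂ) (k₀ e : ℝ) :
    klfb_prop f k₀ e = f (k₀ ^ 2 + e ^ 2) / (((k₀ ^ 2 + e ^ 2 : ℝ)) : ℂ) * (I * k₀ + e) := rfl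

/-- The propagator vanishes where the weight does at large `s`: `f(s) = 0` for `s ≥ r²` and `r ≤ |e|` give `Φ_f(k₀,e) = 0`. -/
theorem klfb_prop_eq_zero_of_le_abs {f : ℝ → ℂ} {r : ℝ} (hr : 0 ≤ r) (hout : ∀ s, r ^ 2 ≤ s → f s = 0) (k₀ : ℝ) {e : ℝ}
    (he : r ≤ |e|) : klfb_prop f k₀ e = 0 := by
  unfold klfb_prop
  rw [hout _ (by nlinarith [sq_abs e, sq_nonneg k₀, abs_nonneg e]), zero_div, zero_mul]

/-- If `Φ_f(k₀,e) ≠ 0` and `f(s) = 0` for `s ≥ r²` (`r ≥ 0`) then `|e| < r`. -/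
theorem klfb_abs_lt_of_prop_ne_zero {f : ℝ → ℂ} {r : ℝ} (hr : 0 ≤ r) (hout : ∀ s, r ^ 2 ≤ s → f s = 0) {k₀ e : ℝ}
    (h : klfb_prop f k₀ e ≠ 0) : |e| < r := by
  by_contra hle
  exact h (klfb_prop_eq_zero_of_le_abs hr hout k₀ (not_lt.mp hle))

/-- Continuity of `e ↦ Φ_f(k₀, e)` for a Lipschitz shell weight vanishing near `s = 0` and at large `s`. -/
theorem klfb_continuous_prop_snd {f : ℝ → ℂ} {Lf Mf r₁ r₂ : ℝ} (hlip : ∀ s s', ‖f s - f s'‖ ≤ Lf * |s - s'|)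
    (hbd : ∀ s, ‖f s‖ ≤ Mf) (hin : ∀ s, s ≤ r₁ ^ 2 → f s = 0) (hout : ∀ s, r₂ ^ 2 ≤ s → f s = 0) (hr₁ : 0 < r₁) (hr₂ : 0 < r₂)
    (k₀ : ℝ) : Continuous fun e : ℝ => klfb_prop f k₀ e := by
  have h := klsp_continuous_snd (g := fun s : ℝ => f s / ((s : ℝ) : ℂ)) (klsp_div_lipschitz hlip hbd hin hr₁)
    (klsp_div_norm_le hbd hin hr₁) (klsp_div_zero hout) hr₂ k₀
  simpa only [klfb_prop] using h

/-- The Cartesian ray point is `u·dir θ` as a `Fin 2`-vector. -/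
theorem klfb_rayPt_vec (δ : (Fin 2 → ℝ) → ℝ) (μ θ e : ℝ) :
    (![(klfb_rayPt δ μ θ e).1, (klfb_rayPt δ μ θ e).2] : Fin 2 → ℝ) = perturbedFermiRadius δ (μ + e) θ • dir θ := by
  unfold klfb_rayPt
  exact klrf_vec_ray θ _

section Frame

variable {a b : ℝ} (B : BandBounds a b) {δ : (Fin 2 → ℝ) → ℝ} (hδ1 : ContDiff ℝ 1 δ) {κ₀ κ₁ : ℝ}
  (hδ : ∀ k : Fin 2 → ℝ, (∀ i, |k i| ≤ π) → |δ k| ≤ κ₀)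
  (hκ : ∀ k : Fin 2 → ℝ, (∀ i, |k i| ≤ π) → ‖fderiv ℝ δ k‖ ≤ κ₁) (hκ₁ : κ₁ < B.Dtmin)

/-! ## §2 The band along the ray, the ray point in the square -/

include B hδ in
/-- **The band is the level along the ray**: `e(u_E(μ+e,θ)·dir θ) = e` at an admissible level (`a ≤ μ+e−κ₀`, `μ+e+κ₀ ≤ b`). -/
theorem klfb_band_rayPt (hδc : Continuous δ) {μ e : ℝ} (hlo : a ≤ μ + e - κ₀) (hhi : μ + e + κ₀ ≤ b) (θ : ℝ) :
    klfb_band δ μ (klfb_rayPt δ μ θ e) = e := by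
  unfold klfb_band
  rw [klfb_rayPt_vec, sqDispersion_add_perturbedFermiRadius B hδc hδ hlo hhi θ]
  ring

include B hδ in
/-- The ray point lies in the open square. -/
theorem klfb_rayPt_mem_square (hδc : Continuous δ) {μ e : ℝ} (hlo : a ≤ μ + e - κ₀) (hhi : μ + e + κ₀ ≤ b) (θ : ℝ) :
    |(klfb_rayPt δ μ θ e).1| < π ∧ |(klfb_rayPt δ μ θ e).2| < π := by
  have h0 := abs_perturbedFermiRadius_smul_dir_lt B hδc hδ hlo hhi θ 0
  have h1 := abs_perturbedFermiRadius_smul_dir_lt B hδc hδ hlo hhi θ 1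
  simp only [Pi.smul_apply, dir, Matrix.cons_val_zero, Matrix.cons_val_one, smul_eq_mul] at h0 h1
  exact ⟨h0, h1⟩

/-! ## §3 The radial integral along one ray in level coordinates -/

include B hδ1 hδ hκ hκ₁ in
/-- **One ray of the coarea on the frame's curve.**  For `h : ℝ × ℝ → E` continuous, supported in the open square and in the tube
`|e| < ē` (margin window `a < μ − ē − κ₀`, `μ + ē + κ₀ < b`), and `θ` any angle:
`∫_{t>0} t • h(t cos θ, t sin θ) dt = ∫_{e ∈ −ē..ē} 𝒥_E(θ,μ+e) • h(ray point) de`. -/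
theorem klfb_ray_integral_eq {E' : Type*} [NormedAddCommGroup E'] [NormedSpace ℝ E'] {h : ℝ × ℝ → E'} (hc : Continuous h)
    {μ ē : ℝ} (hē : 0 ≤ ē) (hlo : a < μ - ē - κ₀) (hhi : μ + ē + κ₀ < b)
    (hsupp : ∀ p : ℝ × ℝ, h p ≠ 0 → |p.1| < π ∧ |p.2| < π ∧ |klfb_band δ μ p| < ē) (θ : ℝ) :
    ∫ t in Ioi (0 : ℝ), t • h (t * Real.cos θ, t * Real.sin θ) =
      ∫ e in (-ē)..ē, klfb_jac δ μ θ e • h (klfb_rayPt δ μ θ e) := by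
  have hδc : Continuous δ := hδ1.continuous
  have hneg : μ + -ē = μ - ē := by ring
  have hsupp' : ∀ p : ℝ × ℝ, h p ≠ 0 → |p.1| < π ∧ |p.2| < π ∧ |sqDispersion ![p.1, p.2] + δ ![p.1, p.2] - μ| < ē :=
    fun p hp => hsupp p hp
  have h1 := klry_ray_substitution hc hē (θ := θ) (ρ := fun e => perturbedFermiRadius δ (μ + e) θ)
    (ρ' := fun e => (rayDispersionDt θ (perturbedFermiRadius δ (μ + e) θ) +
      fderiv ℝ δ (perturbedFermiRadius δ (μ + e) θ • dir θ) (dir θ))⁻¹) ?_ ?_ ?_ ?_ ?_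
  · simpa only [klfb_jac, klfb_rayPt] using h1
  · intro e he
    have hd := klrf_hasDerivAt_level B hδ1 hδ hκ hκ₁ (ν := μ + e) (by linarith [he.1]) (by linarith [he.2]) θ
    have h2' : HasDerivAt (fun e : ℝ => μ + e) 1 e := by simpa using (hasDerivAt_id e).const_add μ
    have := hd.comp e h2'
    rw [mul_one] at this
    exact this
  · exact klrf_continuousOn_invPertDt B hδ1 hδ hκ hκ₁ hlo hhi θ
  · simp only [hneg]
    exact (perturbedFermiRadius_mem_Ioo B hδc hδ hlo.le (by linarith) θ).1
  · simp only [hneg]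
    exact (klrf_level_mono_growth B hδ1 hδ hκ hκ₁ hlo.le hhi.le (by linarith) θ).1
  · intro t ht hnot
    refine klrf_ray_support B hδ1 hδ hκ hκ₁ hlo hhi hsupp' ht ?_
    simpa only [hneg] using hnot

/-! ## §4 The insertion `W_θ = 𝒥_E·A(ray point)` and the shift `σ_θ = e'(ray point) − e` on the window -/

omit B in
/-- **The insertion on the ray**: `W_θ(e) = 𝒥_E(θ,μ+e)·A(u_E(μ+e,θ)·(cos θ, sin θ))`. -/
def klfb_weight (δ : (Fin 2 → ℝ) → ℝ) (μ : ℝ) (A : ℝ × ℝ → ℂ) (θ e : ℝ) : ℂ :=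
  (klfb_jac δ μ θ e : ℂ) * A (klfb_rayPt δ μ θ e)

omit B in
/-- **The energy shift on the ray**: `σ_θ(e) = e'(u_E(μ+e,θ)·(cos θ, sin θ)) − e` for a «shifted band» `e' : ℝ × ℝ → ℝ`. -/
def klfb_shift (δ : (Fin 2 → ℝ) → ℝ) (μ : ℝ) (e' : ℝ × ℝ → ℝ) (θ e : ℝ) : ℝ := e' (klfb_rayPt δ μ θ e) - e

include B hδ1 hδ hκ hκ₁ in
/-- The perturbed radius `e ↦ u_E(μ+e,θ)` is continuous on the window `[−ē, ē]` (margins strict). -/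
theorem klfb_continuousOn_radius {μ ē : ℝ} (hlo : a < μ - ē - κ₀) (hhi : μ + ē + κ₀ < b) (θ : ℝ) :
    ContinuousOn (fun e : ℝ => perturbedFermiRadius δ (μ + e) θ) (Icc (-ē) ē) := by
  intro e he
  have hA : ContinuousAt (fun ν : ℝ => perturbedFermiRadius δ ν θ) (μ + e) :=
    klrf_continuousAt_level B hδ1 hδ hκ hκ₁ (by linarith [he.1]) (by linarith [he.2]) θ
  have hB : Continuous (fun e : ℝ => μ + e) := by fun_prop
  exact (ContinuousAt.comp (f := fun e : ℝ => μ + e) (x := e) hA hB.continuousAt).continuousWithinAt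

include B hδ1 hδ hκ hκ₁ in
/-- The ray point `e ↦ u_E(μ+e,θ)·(cos θ, sin θ)` is continuous on the window. -/
theorem klfb_continuousOn_rayPt {μ ē : ℝ} (hlo : a < μ - ē - κ₀) (hhi : μ + ē + κ₀ < b) (θ : ℝ) :
    ContinuousOn (fun e : ℝ => klfb_rayPt δ μ θ e) (Icc (-ē) ē) := by
  have hu := klfb_continuousOn_radius B hδ1 hδ hκ hκ₁ hlo hhi θ
  unfold klfb_rayPt
  exact (hu.mul continuousOn_const).prodMk (hu.mul continuousOn_const)

include B hδ1 hδ hκ hκ₁ in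
/-- The Jacobian `e ↦ 𝒥_E(θ,μ+e)` is continuous on the window. -/
theorem klfb_continuousOn_jac {μ ē : ℝ} (hlo : a < μ - ē - κ₀) (hhi : μ + ē + κ₀ < b) (θ : ℝ) :
    ContinuousOn (fun e : ℝ => klfb_jac δ μ θ e) (Icc (-ē) ē) := by
  unfold klfb_jac
  exact (klfb_continuousOn_radius B hδ1 hδ hκ hκ₁ hlo hhi θ).mul (klrf_continuousOn_invPertDt B hδ1 hδ hκ hκ₁ hlo hhi θ)

include B hδ1 hδ hκ hκ₁ in
/-- **`W_θ` is continuous on the window** (for a continuous planar weight `A`). -/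
theorem klfb_weight_continuousOn {A : ℝ × ℝ → ℂ} (hA : Continuous A) {μ ē : ℝ} (hlo : a < μ - ē - κ₀) (hhi : μ + ē + κ₀ < b) (θ : ℝ) :
    ContinuousOn (klfb_weight δ μ A θ) (Icc (-ē) ē) := by
  unfold klfb_weight
  refine ContinuousOn.mul ?_ (hA.comp_continuousOn (klfb_continuousOn_rayPt B hδ1 hδ hκ hκ₁ hlo hhi θ))
  exact Complex.continuous_ofReal.comp_continuousOn (klfb_continuousOn_jac B hδ1 hδ hκ hκ₁ hlo hhi θ)

include B hδ1 hδ hκ hκ₁ in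
/-- **`σ_θ` is continuous on the window** (for a continuous shifted band `e'`). -/
theorem klfb_shift_continuousOn {e' : ℝ × ℝ → ℝ} (he' : Continuous e') {μ ē : ℝ} (hlo : a < μ - ē - κ₀) (hhi : μ + ē + κ₀ < b)
    (θ : ℝ) : ContinuousOn (klfb_shift δ μ e' θ) (Icc (-ē) ē) := by
  unfold klfb_shift
  exact (he'.comp_continuousOn (klfb_continuousOn_rayPt B hδ1 hδ hκ hκ₁ hlo hhi θ)).sub continuousOn_id

include B hδ hκ hκ₁ in
/-- **Size of the insertion**: `‖W_θ(e)‖ ≤ A₀·π√2/(Dt_min − κ₁)` at an admissible level, when `‖A‖ ≤ A₀`. -/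
theorem klfb_weight_norm_le (hδc : Continuous δ) {A : ℝ × ℝ → ℂ} {A₀ : ℝ} (hA0 : ∀ p, ‖A p‖ ≤ A₀) {μ e : ℝ}
    (hlo : a ≤ μ + e - κ₀) (hhi : μ + e + κ₀ ≤ b) (θ : ℝ) :
    ‖klfb_weight δ μ A θ e‖ ≤ A₀ * (Real.pi * Real.sqrt 2 / (B.Dtmin - κ₁)) := by
  have hA0' : 0 ≤ A₀ := (norm_nonneg _).trans (hA0 0)
  have hJ0 : 0 ≤ klfb_jac δ μ θ e := klrj_jacobian_nonneg B hδ hκ hκ₁ hδc hlo hhi θ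
  have hJ : klfb_jac δ μ θ e ≤ Real.pi * Real.sqrt 2 / (B.Dtmin - κ₁) := klrj_jacobian_le B hδ hκ hκ₁ hδc hlo hhi θ
  unfold klfb_weight
  rw [norm_mul, Complex.norm_real, Real.norm_of_nonneg hJ0, mul_comm]
  exact mul_le_mul (hA0 _) hJ (hJ0) hA0'

include B hδ1 hδ hκ hκ₁ in
/-- **Lipschitz of the insertion at `e = 0`**: with `‖A‖ ≤ A₀`, `A` radially `A₁`-Lipschitz (`‖A(t cos θ, t sin θ) − A(t' cos θ, t' sin θ)‖ ≤
A₁|t − t'|` for `t, t' ≥ 0`) and a radial Lipschitz bound `κ₂` for `t ↦ Dδ(t·dir θ)[dir θ]` on the ray segment,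
`‖W_θ(e) − W_θ(0)‖ ≤ ((π√2/d)·A₁/d + A₀·(1/d² + π√2(2+κ₂)/d³))·|e|`, `d = Dt_min − κ₁`, at admissible levels `μ`, `μ + e`. -/
theorem klfb_weight_sub_zero_norm_le {A : ℝ × ℝ → ℂ} {A₀ A₁ : ℝ} (hA0 : ∀ p, ‖A p‖ ≤ A₀)
    (hA1 : ∀ θ t t' : ℝ, 0 ≤ t → 0 ≤ t' →
      ‖A (t * Real.cos θ, t * Real.sin θ) - A (t' * Real.cos θ, t' * Real.sin θ)‖ ≤ A₁ * |t - t'|)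
    {κ₂ : ℝ} (hκ₂ : 0 ≤ κ₂) {θ : ℝ}
    (hD2 : ∀ s t : ℝ, s ∈ Icc 0 (π / ‖dir θ‖) → t ∈ Icc 0 (π / ‖dir θ‖) →
      |fderiv ℝ δ (s • dir θ) (dir θ) - fderiv ℝ δ (t • dir θ) (dir θ)| ≤ κ₂ * |s - t|)
    {μ e : ℝ} (hμlo : a ≤ μ - κ₀) (hμhi : μ + κ₀ ≤ b) (hlo : a ≤ μ + e - κ₀) (hhi : μ + e + κ₀ ≤ b) :
    ‖klfb_weight δ μ A θ e - klfb_weight δ μ A θ 0‖ ≤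
      (Real.pi * Real.sqrt 2 / (B.Dtmin - κ₁) * A₁ / (B.Dtmin - κ₁) +
          A₀ * (1 / (B.Dtmin - κ₁) ^ 2 + Real.pi * Real.sqrt 2 * (2 + κ₂) / (B.Dtmin - κ₁) ^ 3)) * |e| := by
  have hδc : Continuous δ := hδ1.continuous
  have hA0' : 0 ≤ A₀ := (norm_nonneg _).trans (hA0 0)
  have hA1' : 0 ≤ A₁ := by
    have h := hA1 0 1 0 zero_le_one le_rfl
    have h0 : (0:ℝ) ≤ ‖A (1 * Real.cos 0, 1 * Real.sin 0) - A (0 * Real.cos 0, 0 * Real.sin 0)‖ := norm_nonneg _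
    have h1 : |(1:ℝ) - 0| = 1 := by norm_num
    rw [h1, mul_one] at h
    exact h0.trans h
  set d := B.Dtmin - κ₁ with hd_def
  have hd : 0 < d := by rw [hd_def]; linarith
  have hμ0lo : a ≤ μ + 0 - κ₀ := by simpa using hμlo
  have hμ0hi : μ + 0 + κ₀ ≤ b := by simpa using hμhi
  -- the two Jacobians and radii
  set J := klfb_jac δ μ θ e with hJ_def
  set J0 := klfb_jac δ μ θ 0 with hJ0_def
  set u := perturbedFermiRadius δ (μ + e) θ with hu_def
  set u0 := perturbedFermiRadius δ (μ + 0) θ with hu0_def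
  have hJnn : 0 ≤ J := klrj_jacobian_nonneg B hδ hκ hκ₁ hδc hlo hhi θ
  have hJle : J ≤ Real.pi * Real.sqrt 2 / d := klrj_jacobian_le B hδ hκ hκ₁ hδc hlo hhi θ
  have hJlip : |J - J0| ≤ (1 / d ^ 2 + Real.pi * Real.sqrt 2 * (2 + κ₂) / d ^ 3) * |(μ + e) - (μ + 0)| :=
    klrj_jacobian_lipschitz B hδ1 hδ hκ hκ₁ hκ₂ hD2 hlo hhi hμ0lo hμ0hi
  have heq : |(μ + e) - (μ + 0)| = |e| := by ring_nf
  rw [heq] at hJlip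
  have hu0nn : 0 ≤ u0 := (perturbedFermiRadius_mem_Ioo B hδc hδ hμ0lo hμ0hi θ).1.le
  have hunn : 0 ≤ u := (perturbedFermiRadius_mem_Ioo B hδc hδ hlo hhi θ).1.le
  have hulip : |u - u0| ≤ |(μ + e) - (μ + 0)| / d := klrf_level_lipschitz B hδ1 hδ hκ hκ₁ hμ0lo hμ0hi hlo hhi θ
  rw [heq] at hulip
  -- the weight difference
  have hAdiff : ‖A (klfb_rayPt δ μ θ e) - A (klfb_rayPt δ μ θ 0)‖ ≤ A₁ * |u - u0| := by
    unfold klfb_rayPt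
    exact hA1 θ u u0 hunn hu0nn
  have hsplit : klfb_weight δ μ A θ e - klfb_weight δ μ A θ 0 =
      (J : ℂ) * (A (klfb_rayPt δ μ θ e) - A (klfb_rayPt δ μ θ 0)) + ((J : ℂ) - (J0 : ℂ)) * A (klfb_rayPt δ μ θ 0) := by
    unfold klfb_weight; ring
  rw [hsplit]
  have h1 : ‖(J : ℂ) * (A (klfb_rayPt δ μ θ e) - A (klfb_rayPt δ μ θ 0))‖ ≤ Real.pi * Real.sqrt 2 / d * (A₁ * (|e| / d)) := by
    rw [norm_mul, Complex.norm_real, Real.norm_of_nonneg hJnn]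
    refine mul_le_mul hJle (hAdiff.trans (mul_le_mul_of_nonneg_left hulip hA1')) (norm_nonneg _) (by positivity)
  have h2 : ‖((J : ℂ) - (J0 : ℂ)) * A (klfb_rayPt δ μ θ 0)‖ ≤ (1 / d ^ 2 + Real.pi * Real.sqrt 2 * (2 + κ₂) / d ^ 3) * |e| * A₀ := by
    rw [norm_mul, ← Complex.ofReal_sub, Complex.norm_real, Real.norm_eq_abs]
    exact mul_le_mul hJlip (hA0 _) (norm_nonneg _) (by positivity)
  calc _ ≤ ‖(J : ℂ) * (A (klfb_rayPt δ μ θ e) - A (klfb_rayPt δ μ θ 0))‖ + ‖((J : ℂ) - (J0 : ℂ)) * A (klfb_rayPt δ μ θ 0)‖ :=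
        norm_add_le _ _
    _ ≤ Real.pi * Real.sqrt 2 / d * (A₁ * (|e| / d)) + (1 / d ^ 2 + Real.pi * Real.sqrt 2 * (2 + κ₂) / d ^ 3) * |e| * A₀ :=
        add_le_add h1 h2
    _ = _ := by field_simp

include B hδ in
/-- **Size of the shift**: `|σ_θ(e)| ≤ δ_max` at an admissible level when `|e' − e| ≤ δ_max` on the open square. -/
theorem klfb_shift_abs_le (hδc : Continuous δ) {e' : ℝ × ℝ → ℝ} {μ δmax : ℝ}
    (he' : ∀ p : ℝ × ℝ, |p.1| < π → |p.2| < π → |e' p - klfb_band δ μ p| ≤ δmax) {e : ℝ}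
    (hlo : a ≤ μ + e - κ₀) (hhi : μ + e + κ₀ ≤ b) (θ : ℝ) : |klfb_shift δ μ e' θ e| ≤ δmax := by
  have hsq := klfb_rayPt_mem_square B hδ hδc hlo hhi θ
  have h := he' _ hsq.1 hsq.2
  rwa [klfb_band_rayPt B hδ hδc hlo hhi θ] at h

end Frame

end Summit.HubbardSuperconductivity.HubbardSuperconductivity.Theorems.KLRegimeSplit

end
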